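/-
COR-CM (cell pub-hodgecm2, stage 2 of the Hodge ladder) — Δ2 BRIDGE (coordinator RESTRUCTURE 2026-08-23), SUBLEMMA **S3** of the
CM-side contract `hcm` (`HcmPieces`, fields `XK ∕ albK ∕ resX ∕ tower_eq`): [Liu2021] Lemma 2.4 (1) «`H¹_{B,τ}(Alb_X, ℚ) ≃ H¹_{B,τ}(X, ℚ)`»
AT THE MODEL'S IDENTITY COMPONENT `P_c = Var.scheme hU h₃ (.pms c)` (a compact ball quotient), BY NAME from the tree theorem
`Model.isIso_bettiCohomology_map_abelJacobi_pms` (`CorCM/Geometry/AlbaneseRangeBallQuotient.lean`), transported to the three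
currencies the bridge uses.  Seat prover-pub-hodgecm2-d2bridge-prove-3-g0-0 (d2bridge-prove-3).  THEOREMS ONLY (no definition, no
carrier, no named fact, no `sorry`); hole-free (no `HodgeCM.Model.*` import); path outside the port manifest.  FRAMING: HC_CM is NOT
proved; «Δ2 BRIDGE CLOSED» is NOT claimed; nothing here is a display or a pointer move.
-/
import Summits.HodgeConjecture.CorCM.Geometry.AlbaneseRangeBallQuotient
import Literature.AlgebraicGeometry.Motives.JacobianBasePoint
import Literature.AlgebraicGeometry.Motives.AlbaneseExistenceComplex
import Literature.AlgebraicGeometry.HodgeTheory.ClassesSupportedOnComplexification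
import HarnessLib

/-!
# Δ2 bridge, S3: Lemma 2.4 (1) of [Liu2021] at the Picard modular surface `P_c`, in three currencies

[Liu2021] Y. Liu, *Fourier–Jacobi cycles and arithmetic relative trace formula*, Camb. J. Math. 9 (2021) = arXiv:2102.11518,
Lemma 2.4 (1) (`FJcycle.tex` l. 1210–1213, proof l. 1220–1228): «for every homomorphism `τ : k → ℂ`, we have a canonical
isomorphism `H¹_{B,τ}(Alb_X, ℚ) ≃ H¹_{B,τ}(X, ℚ)`»; proof: «we pick an element `x ∈ X(π₀(X ⊗_{k,τ} ℂ))`, which induces a morphism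
`(α_X)_x : X ⊗_{k,τ} ℂ → Alb_X ⊗_{k,τ} ℂ` […]. By the property of complex Albanese varieties, the induced map `(α_X)_x^*` […] is an
isomorphism; it is independent of the choice of `x` since translation acts trivially on `H¹_{B,τ}(Alb, ℚ)`.»

In the Δ2 bridge (`HOME/d2bridge/HcmSkeleton.lean` = `CorCM/D2Bridge/HcmPieces.lean`, structure `HcmPieces`, S3 = fields `XK`,
`albK : AK ≃ₗ[ℂ] XK`, `resX`, `tower_eq`) the lemma is consumed ONE CONNECTED COMPONENT AT A TIME: the complex points of Liu's
`X_K ⊗_{E,ι₁} ℂ` are `⊔_{[h]} Γ_h \ 𝔹²`, the model's tower level is a submodule of `Π_h ℂ ⊗_ℚ H¹(P_{Γ_h}(ℂ); ℚ)` restricted to the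
identity component by `c ↦ c 1`, and the target space of `hcm` is `W Γ = ℂ ⊗_ℚ H¹(P_Γ(ℂ); ℚ)` with generators
`geomClass Γ d f = (pull f 1).baseChange ℂ d.α`.  So the S3 datum the assembler needs is, for the component
`P_c = Var.scheme hU h₃ (.pms c)` (`c = pmsCode L ι₁ V Γ`, anisotropic) and an Albanese datum `𝒥 : Jacobian P_c` with a base
point `P` (Liu's `(α_X)_x` on the component is the map `f^P : P_c → Alb P_c`, `Jacobian.abelJacobi`):

* (ℚ) `bijective_pull_abelJacobi_pms`: `(f^P)^* : H¹(Alb P_c(ℂ); ℚ) → H¹(P_c(ℂ); ℚ)` is bijective — THIS IS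
  `Model.isIso_bettiCohomology_map_abelJacobi_pms` read on vectors; `exists_linearEquiv_pull_abelJacobi_pms` packages it;
* (ℂ ⊗ ℚ — the PIN's currency `U.CohC`, `geomClass`) `bijective_baseChange_pull_abelJacobi_pms`: `(f^P)^* ⊗ ℂ` is bijective, and
  `exists_linearEquiv_baseChange_pull_abelJacobi_pms`: an `albK : ℂ ⊗_ℚ H¹(Alb P_c(ℂ); ℚ) ≃ₗ[ℂ] ℂ ⊗_ℚ H¹(P_c(ℂ); ℚ)` with
  `albK.toLinearMap = (BettiUniverse.pull (𝒥.abelJacobi P) 1).baseChange ℂ` EXISTS (at the pin: `LinearEquiv.ofBijective _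
  (bijective_baseChange_pull_abelJacobi_pms …)`) — the shape S4's `geom_eq` composes with (`BettiUniverse.pull_comp`);
* (ℂ) `bijective_complexBetti_map_abelJacobi_pms` / `isIso_complexBetti_map_abelJacobi_pms`: `complexBetti.map (f^P) 1` is an
  isomorphism `H¹(Alb P_c(ℂ); ℂ) ≅ H¹(P_c(ℂ); ℂ)` (through the comparison `ofRatClassBaseChangeEquiv` and its naturality);
* base-point independence in the three currencies (`pull_abelJacobi_eq_of_point`, `baseChange_pull_abelJacobi_eq_of_point`,
  `complexBetti_map_abelJacobi_eq_of_point`; the l. 1228 sentence), and invariance of `f^*` on `H¹` under translation of ANY morphism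
  `f : P_c → A` into an abelian variety (`pull_mul_const`), which is what S4's `f_φ := φ_ℂ ∘ (α_K)_x ∘ (P_Γ ↪ X_{K,ℂ})` needs to
  forget the chosen `x`;
* existence of the data (`exists_jacobian_point_pms`: an Albanese datum and a complex point of `P_c` exist — tree theorems
  `nonempty_jacobian_of_isSmoothProjective_complex_of_dim`, `IsSmoothProjective.nonempty_algPoints`), so the S3 fields are
  instantiable without any new hypothesis.

Everything is proved from tree theorems; the only inputs are the model records `hU`, `h₃` (data) and anisotropy of the code
(a `Prop` about the code, `PicardCode.IsAnisotropic`, true for every `pmsCode L ι₁ V Γ` with `[L:ℚ] > 2`).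
-/

noncomputable section

open scoped TensorProduct
open CategoryTheory Module
open scoped MonObj
open Literature.AlgebraicGeometry.Motives
open Literature.AlgebraicGeometry.HodgeTheory
open Literature.NumberTheory.Automorphic.PicardCM
open Literature.AlgebraicTopology.SingularHomology (singularCohomology)

namespace Summit.HodgeConjecture.CorCM.D2Bridge

variable {hU : BallQuotientUniformisedDatum} {h₃ : CMAbelianVarietyRealised}

/-! ## Existence of the S3 data at `P_c` -/

/-- **The S3 data exist**: the realised Picard modular surface `P_c` (smooth projective, `Var.isSmoothProjective`) has an
Albanese datum `𝒥 : Jacobian P_c` (tree theorem `nonempty_jacobian_of_isSmoothProjective_complex_of_dim`, Serre's criterion) and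
a complex point (Nullstellensatz, `IsSmoothProjective.nonempty_algPoints`) — Liu's «we pick an element `x ∈ X(π₀(X ⊗_{k,τ} ℂ))`»
on the component. [cite: Liu2021, Lemma 2.4 (1), proof l. 1220–1222] -/
theorem exists_jacobian_point_pms (c : PicardCode) :
    ∃ (_ : Jacobian (Var.scheme hU h₃ (.pms c))), Nonempty (AlgPoints (Var.scheme hU h₃ (.pms c)) ℂ) := by
  obtain ⟨𝒥⟩ := nonempty_jacobian_of_isSmoothProjective_complex_of_dim (Var.scheme hU h₃ (.pms c))
    (Var.isSmoothProjective hU h₃ (.pms c))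
  exact ⟨𝒥, (Var.isSmoothProjective hU h₃ (.pms c)).nonempty_algPoints ℂ⟩

/-! ## Currency (ℚ): `(f^P)^* : H¹(Alb P_c(ℂ); ℚ) → H¹(P_c(ℂ); ℚ)` is bijective -/

/-- **[Liu2021, Lemma 2.4 (1)] at `P_c`, rational currency**: `(f^P)^* : H¹(Alb P_c(ℂ); ℚ) → H¹(P_c(ℂ); ℚ)` (`BettiUniverse.pull`)
is bijective — the tree theorem `Model.isIso_bettiCohomology_map_abelJacobi_pms` (ISO(`P_c`) for the compact ball quotient) read on
vectors through `asIso`/`Iso.toLinearEquiv`. [cite: Liu2021, Lemma 2.4 (1) (FJcycle.tex l. 1213)] -/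
theorem bijective_pull_abelJacobi_pms (c : PicardCode) (h : c.IsAnisotropic) (𝒥 : Jacobian (Var.scheme hU h₃ (.pms c)))
    (P : AlgPoints (Var.scheme hU h₃ (.pms c)) ℂ) : Function.Bijective (BettiUniverse.pull (𝒥.abelJacobi P) 1) :=
  haveI := Model.isIso_bettiCohomology_map_abelJacobi_pms c h 𝒥 P
  (asIso (bettiCohomology.map (𝒥.abelJacobi P) 1)).toLinearEquiv.bijective

/-- The rational currency packaged: a linear equivalence `H¹(Alb P_c(ℂ); ℚ) ≃ₗ[ℚ] H¹(P_c(ℂ); ℚ)` whose underlying map IS `(f^P)^*`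
exists. [cite: Liu2021, Lemma 2.4 (1) (l. 1213)] -/
theorem exists_linearEquiv_pull_abelJacobi_pms (c : PicardCode) (h : c.IsAnisotropic) (𝒥 : Jacobian (Var.scheme hU h₃ (.pms c)))
    (P : AlgPoints (Var.scheme hU h₃ (.pms c)) ℂ) :
    ∃ e : bettiCohomology 𝒥.J.X 1 ≃ₗ[ℚ] bettiCohomology (Var.scheme hU h₃ (.pms c)) 1,
      e.toLinearMap = BettiUniverse.pull (𝒥.abelJacobi P) 1 :=
  ⟨LinearEquiv.ofBijective _ (bijective_pull_abelJacobi_pms c h 𝒥 P), rfl⟩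

/-- **Base-point independence** («it is independent of the choice of `x` since translation acts trivially on `H¹_{B,τ}(Alb, ℚ)`»,
l. 1226–1228; tree `Jacobian.bettiCohomology_map_abelJacobi_eq`). [cite: Liu2021, Lemma 2.4 (1), proof l. 1226–1228] -/
theorem pull_abelJacobi_eq_of_point (c : PicardCode) (𝒥 : Jacobian (Var.scheme hU h₃ (.pms c)))
    (P P' : AlgPoints (Var.scheme hU h₃ (.pms c)) ℂ) (i : ℕ) :
    BettiUniverse.pull (𝒥.abelJacobi P') i = BettiUniverse.pull (𝒥.abelJacobi P) i := by
  change (bettiCohomology.map (𝒥.abelJacobi P') i).hom = (bettiCohomology.map (𝒥.abelJacobi P) i).hom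
  rw [Jacobian.bettiCohomology_map_abelJacobi_eq 𝒥 P P' i]

/-- **Translation acts trivially on `Hⁱ`** for ANY morphism into an abelian variety: for `f : P_c → A` and a point `a ∈ A(ℂ)`,
`(f · a)^* = f^*` on `Hⁱ(A(ℂ); ℚ)` (tree `AbelianVariety.bettiCohomology_map_mul_const`: translations of the path-connected group
`A(ℂ)` are homotopic to the identity).  This is the sentence S4 uses to forget the chosen point `x` in
`f_φ = φ_ℂ ∘ (α_K)_x ∘ (P_Γ ↪ X_{K,ℂ})`. [cite: Liu2021, Lemma 2.4 (1), proof l. 1226–1228] -/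
theorem pull_mul_const (c : PicardCode) {A : AbelianVariety ℂ} (f : Var.scheme hU h₃ (.pms c) ⟶ A.X) (a : A.Points ℂ) (i : ℕ) :
    BettiUniverse.pull (f * (toSpecOver (Var.scheme hU h₃ (.pms c)) ≫ a)) i = BettiUniverse.pull f i := by
  change (bettiCohomology.map (f * (toSpecOver _ ≫ a)) i).hom = (bettiCohomology.map f i).hom
  rw [AbelianVariety.bettiCohomology_map_mul_const f a i]

/-! ## Currency (ℂ ⊗ ℚ): the PIN's `U.CohC` / `geomClass` currency -/

/-- **[Liu2021, Lemma 2.4 (1)] at `P_c`, complexified — the S3 field `albK` at the identity component, as a bijection**: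
`(f^P)^* ⊗ ℂ : ℂ ⊗_ℚ H¹(Alb P_c(ℂ); ℚ) → ℂ ⊗_ℚ H¹(P_c(ℂ); ℚ)` is bijective (base change of the rational equivalence).  Its target
is the pin's `W Γ = U.CohC (U.pms L ι₁ V Γ) 1` at `c = pmsCode L ι₁ V Γ`, and `(pull f 1).baseChange ℂ` is the shape of
`geomClass Γ d f`. [cite: Liu2021, Lemma 2.4 (1) (l. 1213, 1224)] -/
theorem bijective_baseChange_pull_abelJacobi_pms (c : PicardCode) (h : c.IsAnisotropic)
    (𝒥 : Jacobian (Var.scheme hU h₃ (.pms c))) (P : AlgPoints (Var.scheme hU h₃ (.pms c)) ℂ) :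
    Function.Bijective ((BettiUniverse.pull (𝒥.abelJacobi P) 1).baseChange ℂ) := by
  obtain ⟨e, he⟩ := exists_linearEquiv_pull_abelJacobi_pms c h 𝒥 P
  rw [← he, ← LinearEquiv.coe_baseChange]
  exact (e.baseChange ℚ ℂ _ _).bijective

/-- The complexified currency packaged: an `albK : ℂ ⊗_ℚ H¹(Alb P_c(ℂ); ℚ) ≃ₗ[ℂ] ℂ ⊗_ℚ H¹(P_c(ℂ); ℚ)` with
`albK.toLinearMap = (pull (f^P) 1).baseChange ℂ` exists (`LinearEquiv.ofBijective`). [cite: Liu2021, Lemma 2.4 (1) (l. 1213)] -/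
theorem exists_linearEquiv_baseChange_pull_abelJacobi_pms (c : PicardCode) (h : c.IsAnisotropic)
    (𝒥 : Jacobian (Var.scheme hU h₃ (.pms c))) (P : AlgPoints (Var.scheme hU h₃ (.pms c)) ℂ) :
    ∃ e : ℂ ⊗[ℚ] bettiCohomology 𝒥.J.X 1 ≃ₗ[ℂ] ℂ ⊗[ℚ] bettiCohomology (Var.scheme hU h₃ (.pms c)) 1,
      e.toLinearMap = (BettiUniverse.pull (𝒥.abelJacobi P) 1).baseChange ℂ :=
  ⟨LinearEquiv.ofBijective _ (bijective_baseChange_pull_abelJacobi_pms c h 𝒥 P), rfl⟩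

/-- Base-point independence, complexified. [cite: Liu2021, Lemma 2.4 (1), proof l. 1226–1228] -/
theorem baseChange_pull_abelJacobi_eq_of_point (c : PicardCode) (𝒥 : Jacobian (Var.scheme hU h₃ (.pms c)))
    (P P' : AlgPoints (Var.scheme hU h₃ (.pms c)) ℂ) (i : ℕ) :
    (BettiUniverse.pull (𝒥.abelJacobi P') i).baseChange ℂ = (BettiUniverse.pull (𝒥.abelJacobi P) i).baseChange ℂ := by
  rw [pull_abelJacobi_eq_of_point c 𝒥 P P' i]

/-! ## Currency (ℂ): `(f^P)^* : H¹(Alb P_c(ℂ); ℂ) → H¹(P_c(ℂ); ℂ)` is an isomorphism -/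

/-- Naturality of the comparison `β : ℂ ⊗_ℚ Hᵏ(−(ℂ); ℚ) → Hᵏ(−(ℂ); ℂ)` in the `BettiUniverse.pull` spelling
(tree `HodgeModel.ofRatClassBaseChange_baseChange_map`). [folklore] -/
theorem ofRatClassBaseChange_baseChange_pull {X Y : SchemeOver ℂ} (g : Y ⟶ X) (k : ℕ) (x : ℂ ⊗[ℚ] bettiCohomology X k) :
    ofRatClassBaseChange (ComplexPoints Y) k ((BettiUniverse.pull g k).baseChange ℂ x) =
      (complexBetti.map g k).hom (ofRatClassBaseChange (ComplexPoints X) k x) :=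
  HodgeModel.ofRatClassBaseChange_baseChange_map g k x

/-- **[Liu2021, Lemma 2.4 (1)] at `P_c`, complex coefficients**: `(f^P)^* = complexBetti.map (f^P) 1 : H¹(Alb P_c(ℂ); ℂ) → H¹(P_c(ℂ); ℂ)`
is bijective — the complexified rational bijection conjugated by the comparison isomorphisms `β : ℂ ⊗_ℚ H¹(−(ℂ); ℚ) ≃ H¹(−(ℂ); ℂ)`
of the two smooth projective varieties `Alb P_c` (`AbelianVariety.isSmoothProjective_holds`) and `P_c` (`Var.isSmoothProjective`).
[cite: Liu2021, Lemma 2.4 (1) (l. 1213)] -/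
theorem bijective_complexBetti_map_abelJacobi_pms (c : PicardCode) (h : c.IsAnisotropic)
    (𝒥 : Jacobian (Var.scheme hU h₃ (.pms c))) (P : AlgPoints (Var.scheme hU h₃ (.pms c)) ℂ) :
    Function.Bijective (complexBetti.map (𝒥.abelJacobi P) 1).hom := by
  set βA := ofRatClassBaseChangeEquiv (AbelianVariety.isSmoothProjective_holds (A := 𝒥.J)) 1 with hβA
  set βX := ofRatClassBaseChangeEquiv (Var.isSmoothProjective hU h₃ (.pms c)) 1 with hβX
  have hcomp : ⇑(complexBetti.map (𝒥.abelJacobi P) 1).hom =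
      ⇑βX ∘ ⇑((BettiUniverse.pull (𝒥.abelJacobi P) 1).baseChange ℂ) ∘ ⇑βA.symm := by
    funext y
    obtain ⟨x, rfl⟩ := βA.surjective y
    simp only [Function.comp_apply, LinearEquiv.symm_apply_apply]
    rw [hβA, hβX, ofRatClassBaseChangeEquiv_apply, ofRatClassBaseChangeEquiv_apply]
    exact (ofRatClassBaseChange_baseChange_pull (𝒥.abelJacobi P) 1 x).symm
  rw [hcomp]
  exact βX.bijective.comp ((bijective_baseChange_pull_abelJacobi_pms c h 𝒥 P).comp βA.symm.bijective)

/-- … hence an isomorphism in `ModuleCat ℂ`. [cite: Liu2021, Lemma 2.4 (1) (l. 1213)] -/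
theorem isIso_complexBetti_map_abelJacobi_pms (c : PicardCode) (h : c.IsAnisotropic)
    (𝒥 : Jacobian (Var.scheme hU h₃ (.pms c))) (P : AlgPoints (Var.scheme hU h₃ (.pms c)) ℂ) :
    IsIso (complexBetti.map (𝒥.abelJacobi P) 1) :=
  (ConcreteCategory.isIso_iff_bijective _).2 (bijective_complexBetti_map_abelJacobi_pms c h 𝒥 P)

/-- The complex currency packaged: a linear equivalence `H¹(Alb P_c(ℂ); ℂ) ≃ₗ[ℂ] H¹(P_c(ℂ); ℂ)` that IS `complexBetti.map (f^P) 1` on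
vectors exists. [cite: Liu2021, Lemma 2.4 (1) (l. 1213)] -/
theorem exists_linearEquiv_complexBetti_map_abelJacobi_pms (c : PicardCode) (h : c.IsAnisotropic)
    (𝒥 : Jacobian (Var.scheme hU h₃ (.pms c))) (P : AlgPoints (Var.scheme hU h₃ (.pms c)) ℂ) :
    ∃ e : complexBetti 𝒥.J.X 1 ≃ₗ[ℂ] complexBetti (Var.scheme hU h₃ (.pms c)) 1,
      e.toLinearMap = (complexBetti.map (𝒥.abelJacobi P) 1).hom :=
  ⟨LinearEquiv.ofBijective _ (bijective_complexBetti_map_abelJacobi_pms c h 𝒥 P), rfl⟩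

/-- Base-point independence, complex coefficients (`f^{P'}` is a translate of `f^P`, `Jacobian.abelJacobi_eq_mul_const`, and a
translation of the path-connected group `A(ℂ)` is homotopic to the identity, `ContinuousMap.homotopic_mulRight_id`, so acts trivially
on singular cohomology, `singularCohomology.map_eq_of_homotopic'`). [cite: Liu2021, Lemma 2.4 (1), proof l. 1226–1228] -/
theorem complexBetti_map_abelJacobi_eq_of_point (c : PicardCode) (𝒥 : Jacobian (Var.scheme hU h₃ (.pms c)))
    (P P' : AlgPoints (Var.scheme hU h₃ (.pms c)) ℂ) (i : ℕ) :
    complexBetti.map (𝒥.abelJacobi P') i = complexBetti.map (𝒥.abelJacobi P) i := by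
  rw [𝒥.abelJacobi_eq_mul_const P P']
  change singularCohomology.map ℂ ℂ (AlgPoints.mapContinuous (L := ℂ)
    (𝒥.abelJacobi P * (toSpecOver _ ≫ (P' ≫ 𝒥.abelJacobi P)⁻¹))) i = _
  rw [AbelianVariety.mapContinuous_mul_const (A := 𝒥.J), singularCohomology.map_comp,
    singularCohomology.map_eq_of_homotopic' ℂ ℂ
      (Literature.AlgebraicTopology.SingularHomology.ContinuousMap.homotopic_mulRight_id _) i,
    singularCohomology.map_id, Category.id_comp]

end Summit.HodgeConjecture.CorCM.D2Bridge

end
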